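import Summits.Ventures.AbcSig.Recipes.EisPackage
import Summits.Ventures.AbcSig.Sieve.CertificateModN

/-!
# Venture AbcSig — discharging a residual (orbit, exponent) pair by a kernel SIEVE certificate on a RE-BASED presentation of the orbit

HONEST FRAMING. Glue file of a COMPUTATION cell (`pub-abcsig`); no Diophantine statement, no claim on ABC or any summit.
Context: a level file's kernel certificate works in the presentation `ℤ[θ]` of its orbit data `o` (θ = the engine's generator);
at a prime `n` dividing the index of `ℤ[θ]` in the maximal order the prime-ideal sieve of [BS04, Prop. 4.3] may eliminate `n`
over `O_K` while no certificate exists in the `θ`-coordinates (the coefficient denominators `d_ℓ` vanish mod `n`). The census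
engines sieve over `O_K`; the rows then carried such pairs as CITED hypotheses. This file lets a row replace that citation by
a kernel certificate on a second datum `X` presenting the SAME newforms with another generator (e.g. `θ' = c_5`):

* `NewformModel.excludesStd_of_eliminated` — `BS04Package` + `o.Eliminated bs04Allowed n` (any kernel certificate of
  `Sieve/Certificate.lean` / `Sieve/CertificateModN.lean`) ⇒ `M.ExcludesStd N o n`.
* `NewformModel.excludesStd_of_rematch` — the same for `o` from a certificate on `X`, under the COMPUTED hypothesis
  `∀ f, M.Matches f o → M.Matches f X` ("every newform carrying the data `o` also carries the data `X`"; true in the intended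
  model because `o` and `X` are two presentations of one Hecke eigenvalue system — certified outside Lean by the transcription
  audit's exact isomorphism check, plean/g5/THETAVERIFY-RECORD.md; of the same epistemic kind as `DataComplete` / `Refines`).

References: [BS04] Bennett–Skinner, Canad. J. Math. 56 (2004), Prop. 4.3, (3.1), Lemma 4.2; `Recipes/BS04.lean`
(`NewformModel.not_arisesMod_of_eliminated`), `Recipes/EisPackage.lean` (`ExcludesStd`, `Standing`).
-/

namespace Summit.Ventures.AbcSig

/-- **Kernel sieve certificate ⇒ standing-datum exclusion.** If the orbit data `o` are sieve-eliminated at the exponent `n`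
(against `bs04Allowed`) and every listed entry is at an odd prime not dividing the level, then no standing datum of exponent `n`
has its mod-`n` representation arising from a newform matching `o` (modulo the CITED package `BS04Package`). -/
theorem NewformModel.excludesStd_of_eliminated (M : NewformModel) (hP : M.BS04Package) {N : ℕ} (o : OrbitData) (n : ℕ)
    (helim : o.Eliminated bs04Allowed n) (hgood : ∀ e ∈ o.coeffs, e.ell.Prime ∧ e.ell ≠ 2 ∧ ¬ e.ell ∣ N) :
    M.ExcludesStd N o n := by
  intro S κ hS hn f hfo harises
  obtain ⟨hA, hB, hC, hsq, hprime, h7, hndvd, hfree, hsol, hab1, hab2, hcase⟩ := hS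
  obtain ⟨-, hmod⟩ := hP S κ hA hB hC hsq hprime h7 hndvd hfree hsol hab1 hab2 hcase
  have h := M.not_arisesMod_of_eliminated f o hfo n bs04Allowed helim hgood
  rw [← hn] at h
  exact h (hmod N f harises)

/-- **Re-based presentation.** If every newform matching `o` also matches the data `X` (COMPUTED hypothesis, see the module
docstring) and `X` is sieve-eliminated at `n` in the kernel, then `M.ExcludesStd N o n`. -/
theorem NewformModel.excludesStd_of_rematch (M : NewformModel) (hP : M.BS04Package) {N : ℕ} (o X : OrbitData)
    (hM : ∀ f : M.Form N, M.Matches f o → M.Matches f X) (n : ℕ)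
    (helim : X.Eliminated bs04Allowed n) (hgood : ∀ e ∈ X.coeffs, e.ell.Prime ∧ e.ell ≠ 2 ∧ ¬ e.ell ∣ N) :
    M.ExcludesStd N o n := by
  intro S κ hS hn f hfo harises
  exact M.excludesStd_of_eliminated hP X n helim hgood S κ hS hn f (hM f hfo) harises

end Summit.Ventures.AbcSig
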